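import Mathlib
import HarnessLib
import Summits.Parity.BatemanHorn.Theses.AlmostPrimeZeros
import Summits.Parity.BatemanHorn.Theorems.AlmostPrimeZerosHadamardBookkeeping
import Summits.Parity.BatemanHorn.Theorems.AlmostPrimeZerosSystemMertens
import Summits.Parity.BatemanHorn.Theorems.AlmostPrimeZerosSystemZeroRepulsionLatticeSum
import Summits.Parity.BatemanHorn.Theorems.AlmostPrimeZerosSystemZeroRepulsionParityContent

/-!
# The rough parity content of lattice domination (crux stmt-Parity-11291, line `buchstab-flow-hyperbolicity`,
joint `FibreUniversality` — kernel NECESSITY form, not a proof)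

Crux `Summit.Parity.BatemanHorn.Theses.AlmostPrimeZeros.SystemZeroRepulsion`.  The line bounds `T(S_x)` through
LATTICE DOMINATION of the rough polynomial `R_{x,y}(X) = Σ_{0 ≤ n ≤ x} X^{roughStat f y n}`,
`roughStat f y n = Σ_i Σ_{p^v ∥ f_i(n), p > y} min(v,2)` (no root within `r₀ ∈ (0,1]` of `1`, at most `k·m + C₀`
roots with `‖1 − ρ‖ < m + 1` for every `m`), which the joint `FibreUniversality` is to transfer from the integers
to every Bateman–Horn system.  Everything below is PROVED (theorems only, statements written out over existing
declarations); it records what any proof of that joint delivers at `z = −1`.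

* `roughLiouville_of_latticeDominated` (A, for ANY exponent sequence `s`): lattice domination of
  `Σ_{n ≤ x} X^{s n}` gives `‖Σ_{n ≤ x} (−1)^{s n}‖ ≤ (x+1)·exp(−2·mean(s) + 2·(C₀/r₀² + k·π²/6))` — Hadamard
  bookkeeping at `z = −1` (`…EulerSpeciesFactorisation.norm_sum_neg_one_pow_le`, from
  `…Theorems.hadamardBookkeeping_proof`) and the Abel-summation bound `…BuchstabFlowHyperbolicity.latticeSum`.
* `roughMertens_lower` (B): for a Bateman–Horn system `f = (f_1,…,f_k)` and `2 ≤ y ≤ x`,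
  `mean_{n ≤ x} roughStat f y n ≥ k·(log log x − log log y) − C_f` (along each irreducible `f_i`:
  `roughStat ≥ #{y < p ≤ x : p ∣ f_i(n)}`, `#{n ≤ x : p ∣ f_i(n)} ≥ ρ_i(p)·⌊(x+1)/p⌋`, and the tree's two-sided
  `Σ_{p ≤ t} ρ_i(p)/p = log log t + O(1)`); `roughMertens_lower_cutoff`: at the line's cut
  `y_A(x) = ⌊exp(log x/(log log x)^A)⌋₊` the mean is `≥ k·A·log log log x − C_f` for `x ≥ x₀(A)`.
* `roughLiouvilleSaving_of_latticeDominated` (A + B): lattice domination of `R_{x,y}` along `f` forces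
  `‖Σ_{n ≤ x} (−1)^{roughStat f y n}‖ ≤ e^{C_f + 2(C₀/r₀² + kπ²/6)}·(x+1)·(log y/log x)^{2k}`, and
  `roughLiouvilleSaving_of_roughLatticeCount`: the conclusion of `FibreUniversality` for `f` (the skeleton's
  `RoughLatticeCountFor f`, written out) gives
  `‖Σ_{n ≤ x} (−1)^{roughStat f (y_A x) n}‖ ≤ C·(x+1)/((log log x)^A)^{2k}` for `x ≥ x₀`.

`(−1)^{roughStat f y n} = ∏_i g_y(f_i(n))` for the multiplicative `g_y` with `g_y(p^v) = −1` exactly when `p > y` and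
`v = 1` (`g_y = λ = μ` on squarefree `y`-rough numbers), so the last bound is a rough Chowla/Liouville cancellation
along `f` saving a power of `log log x` (`f = (X, X+2)`: a rough two-point correlation; `deg f ≥ 2`: rough one-point
Chowla along `f`) — the content behind `Literature.Barriers.Parity.SelbergParityBarrier`, relocated to the roughest
species.  This file records the implication; it does not advance it.
-/

open scoped BigOperators

namespace Summit.Parity.BatemanHorn.Cruxes.SystemZeroRepulsion.BuchstabFlowHyperbolicity

open Polynomial Finset
open Literature.NumberTheory.Sieve
open Summit.Parity.BatemanHorn.Theorems.AlmostPrimeZeros.SystemMertens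

/-- **Theorem A — lattice domination forces cancellation in the alternating exponent sum.**  For ANY
`s : ℕ → ℕ` and `P = Σ_{n ≤ x} X^{s n} ∈ ℂ[X]`: if no root of `P` lies within `r₀ ∈ (0,1]` of `1` and for every
`m : ℕ` at most `k·m + C₀` roots satisfy `‖1 − ρ‖ < m + 1` (roots with multiplicity), then
`‖Σ_{n ≤ x} (−1)^{s n}‖ ≤ (x+1)·exp(−2·(Σ_n s n)/(x+1) + 2·(C₀/r₀² + k·π²/6))`.  Hadamard bookkeeping at `z = −1`
(`norm_sum_neg_one_pow_le`: `P(1) = x+1`, `P′(1) = Σ s n`, `‖1 − (−1)‖² = 4`), `latticeSum`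
(`Σ_ρ ‖1 − ρ‖⁻² ≤ C₀/r₀² + k·π²/6`) and monotonicity of `exp`.  With `s = roughStat f y` the left side is the
rough Liouville sum along `f`. -/
theorem roughLiouville_of_latticeDominated : ∀ (k C₀ : ℕ) (r₀ : ℝ) (s : ℕ → ℕ) (x : ℕ), 0 < r₀ → r₀ ≤ 1 →
    (∀ ρ ∈ (∑ n ∈ Finset.range (x + 1), (Polynomial.X : Polynomial ℂ) ^ (s n)).roots, r₀ ≤ ‖(1 : ℂ) - ρ‖) →
    (∀ m : ℕ, ((∑ n ∈ Finset.range (x + 1), (Polynomial.X : Polynomial ℂ) ^ (s n)).roots.filter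
      fun ρ : ℂ => ‖(1 : ℂ) - ρ‖ < (m : ℝ) + 1).card ≤ k * m + C₀) →
    ‖∑ n ∈ Finset.range (x + 1), (-1 : ℂ) ^ (s n)‖ ≤
      ((x : ℝ) + 1) * Real.exp (-2 * ((∑ n ∈ Finset.range (x + 1), (s n : ℝ)) / ((x : ℝ) + 1)) +
        2 * ((C₀ : ℝ) / r₀ ^ 2 + (k : ℝ) * (Real.pi ^ 2 / 6))) := by
  intro k C₀ r₀ s x hr₀ hr₁ hfar hcount
  have hH := EulerSpeciesFactorisation.norm_sum_neg_one_pow_le s x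
  have hT := latticeSum k C₀ r₀ _ hr₀ hr₁ hfar hcount
  have hx : (0 : ℝ) ≤ (x : ℝ) + 1 := by positivity
  refine hH.trans (mul_le_mul_of_nonneg_left (Real.exp_le_exp.mpr ?_) hx)
  linarith

/-- **Rough lower splitting, summed.** `Σ_{y < p ≤ x prime} #{n ≤ x : p ∣ G n ≠ 0} ≤ Σ_{n ≤ x} s_{>y}(G n)`,
where `s_{>y}(m) = Σ_{p^v ∥ m, p > y} min(v,2) ≥ #{p > y : p ∣ m}`. -/
theorem le_sum_roughCapped (G : ℕ → ℕ) (x y : ℕ) :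
    ∑ p ∈ (Nat.primesLE x).filter (fun p => y < p), #((range (x + 1)).filter fun n => p ∣ G n ∧ G n ≠ 0) ≤
      ∑ n ∈ range (x + 1), ((G n).factorization.sum fun p v => if y < p then min v 2 else 0) := by
  rw [← sum_card_filter_comm (range (x + 1)) ((Nat.primesLE x).filter fun p => y < p)
    (fun n p => p ∣ G n ∧ G n ≠ 0)]
  refine sum_le_sum fun n _ => ?_
  rcases eq_or_ne (G n) 0 with h0 | h0
  · simp [h0]
  unfold Finsupp.sum
  rw [Nat.support_factorization]
  calc #(((Nat.primesLE x).filter fun p => y < p).filter fun p => p ∣ G n ∧ G n ≠ 0)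
      ≤ #((G n).primeFactors.filter fun p => y < p) := by
        refine card_le_card fun p hp => ?_
        simp only [mem_filter, Nat.mem_primesLE, Nat.mem_primeFactors] at hp ⊢
        exact ⟨⟨hp.1.1.2, hp.2.1, hp.2.2⟩, hp.1.2⟩
    _ = ∑ p ∈ (G n).primeFactors, (if y < p then 1 else 0) := by rw [card_filter]
    _ ≤ ∑ p ∈ (G n).primeFactors, (if y < p then min ((G n).factorization p) 2 else 0) := by
        refine sum_le_sum fun p hp => ?_
        have h1 : 0 < (G n).factorization p :=
          (Nat.prime_of_mem_primeFactors hp).factorization_pos_of_dvd h0 (Nat.dvd_of_mem_primeFactors hp)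
        split_ifs
        · exact le_min h1 (by norm_num)
        · exact le_rfl

/-- **Rough lower count** (in `ℕ`): if `g(n) > 0` for `n ≥ n₀` then
`Σ_{y < p ≤ x} ρ(p)·⌊(x+1)/p⌋ ≤ Σ_{n ≤ x} s_{>y}(g(n)⁺) + n₀·π(x)` (periodicity of `p ∣ g(n)` in `n`). -/
theorem sum_rootCount_rough_le (g : ℤ[X]) (x y : ℕ) {n₀ : ℕ}
    (hpos : ∀ n : ℕ, n₀ ≤ n → 0 < g.eval (n : ℤ)) :
    ∑ p ∈ (Nat.primesLE x).filter (fun p => y < p), polyRootCountMod ![g] p * ((x + 1) / p) ≤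
      ∑ n ∈ range (x + 1), ((g.eval (n : ℤ)).toNat.factorization.sum
          fun p v => if y < p then min v 2 else 0) + n₀ * #(Nat.primesLE x) := by
  have h1 := le_sum_roughCapped (fun n => (g.eval (n : ℤ)).toNat) x y
  have h2 : ∑ p ∈ (Nat.primesLE x).filter (fun p => y < p), polyRootCountMod ![g] p * ((x + 1) / p) ≤
      ∑ p ∈ (Nat.primesLE x).filter (fun p => y < p),
        (#((range (x + 1)).filter fun n : ℕ =>
          p ∣ (g.eval (n : ℤ)).toNat ∧ (g.eval (n : ℤ)).toNat ≠ 0) + n₀) := by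
    refine sum_le_sum fun p hp => ?_
    have hp0 : 0 < p := (Nat.mem_primesLE.1 (mem_filter.1 hp).1).2.pos
    exact (le_card_filter_range_dvd_eval g hp0 (x + 1)).trans
      (card_filter_dvd_eval_le_add g p (x + 1) hpos)
  rw [sum_add_distrib, sum_const, smul_eq_mul] at h2
  have h4 : #((Nat.primesLE x).filter fun p => y < p) * n₀ ≤ n₀ * #(Nat.primesLE x) := by
    rw [mul_comm]; exact Nat.mul_le_mul_left _ (card_filter_le _ _)
  omega

/-- Splitting the prime sum at `y ≤ x`: `Σ_{p ≤ x} a p = Σ_{y < p ≤ x} a p + Σ_{p ≤ y} a p`. -/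
theorem sum_primesLE_eq_rough_add (a : ℕ → ℝ) {x y : ℕ} (hyx : y ≤ x) :
    ∑ p ∈ Nat.primesLE x, a p =
      ∑ p ∈ (Nat.primesLE x).filter (fun p => y < p), a p + ∑ p ∈ Nat.primesLE y, a p := by
  have h : (Nat.primesLE x).filter (fun p => ¬ y < p) = Nat.primesLE y := by
    ext p
    simp only [mem_filter, Nat.mem_primesLE, not_lt]
    exact ⟨fun h => ⟨h.2, h.1.2⟩, fun h => ⟨⟨h.1.trans hyx, h.2⟩, h.1⟩⟩
  rw [← sum_filter_add_sum_filter_not (Nat.primesLE x) (fun p => y < p), h]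

/-- **Rough Mertens from below along one irreducible polynomial.**  For `g ∈ ℤ[X]` irreducible of positive
degree with positive leading coefficient there is `C` with
`log log x − log log y − C ≤ (x+1)⁻¹ Σ_{0 ≤ n ≤ x} s_{>y}(g(n)⁺)` for all `2 ≤ y ≤ x`: the rough lower count,
`ρ_g(p) ≤ deg g`, and the tree's `Σ_{p ≤ y} ρ_g(p)/p ≤ log log y + C₁`
(`exists_sum_primesLE_rootCount_div_le`), `log log x − C₂ ≤ Σ_{p ≤ x} ρ_g(p)/p`
(`exists_loglog_sub_le_sum_rootCount_div`); `C = C₁ + C₂ + deg g + n₀`. -/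
theorem loglog_sub_loglog_sub_le_sum_roughCapped_div {g : ℤ[X]} (hirr : Irreducible g)
    (hdeg : 0 < g.natDegree) (hlc : 0 < g.leadingCoeff) :
    ∃ C : ℝ, ∀ x y : ℕ, 2 ≤ y → y ≤ x →
      Real.log (Real.log (x : ℝ)) - Real.log (Real.log (y : ℝ)) - C ≤
        ((∑ n ∈ range (x + 1), ((g.eval (n : ℤ)).toNat.factorization.sum
          fun p v => if y < p then min v 2 else 0) : ℕ) : ℝ) / ((x : ℝ) + 1) := by
  obtain ⟨-, -, -, hρd⟩ := exists_rootCount_primePow_le hirr hdeg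
  obtain ⟨C₁, hC₁⟩ := exists_sum_primesLE_rootCount_div_le hirr hdeg
  obtain ⟨C₂, hC₂⟩ := exists_loglog_sub_le_sum_rootCount_div hirr hdeg hlc
  obtain ⟨n₀, hn₀⟩ := Filter.eventually_atTop.1 (eventually_eval_natCast_pos hdeg hlc)
  set d : ℕ := g.natDegree
  refine ⟨C₁ + C₂ + (d + n₀), fun x y hy hyx => ?_⟩
  set Y : ℝ := (x : ℝ) + 1 with hY
  set S : ℝ := ∑ p ∈ (Nat.primesLE x).filter (fun p => y < p), (polyRootCountMod ![g] p : ℝ) / p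
  set T : ℕ := ∑ n ∈ range (x + 1), ((g.eval (n : ℤ)).toNat.factorization.sum
    fun p v => if y < p then min v 2 else 0)
  have hY0 : 0 < Y := by positivity
  have hYnat : ((x + 1 : ℕ) : ℝ) = Y := by push_cast; rfl
  have hP : (#(Nat.primesLE x) : ℝ) ≤ Y := by
    rw [← hYnat]
    exact_mod_cast (card_le_card (filter_subset _ _)).trans (card_range (x + 1)).le
  have hP' : (#((Nat.primesLE x).filter fun p => y < p) : ℝ) ≤ Y :=
    le_trans (by exact_mod_cast card_filter_le _ _) hP
  -- the Mertens window `S ≥ log log x − log log y − C₁ − C₂`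
  have hS : Real.log (Real.log (x : ℝ)) - Real.log (Real.log (y : ℝ)) - (C₁ + C₂) ≤ S := by
    have h := sum_primesLE_eq_rough_add (fun p => (polyRootCountMod ![g] p : ℝ) / p) hyx
    linarith [hC₁ y hy, hC₂ x (hy.trans hyx)]
  -- the lower count `Y·S − (d + n₀)·Y ≤ T`
  have hlower : Y * S - (d + n₀) * Y ≤ T := by
    have h0' : ∑ p ∈ (Nat.primesLE x).filter (fun p => y < p),
        (polyRootCountMod ![g] p : ℝ) * (((x + 1) / p : ℕ) : ℝ) ≤ T + n₀ * #(Nat.primesLE x) := by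
      exact_mod_cast sum_rootCount_rough_le g x y hn₀
    have h1 : Y * S - d * #((Nat.primesLE x).filter fun p => y < p) ≤
        ∑ p ∈ (Nat.primesLE x).filter (fun p => y < p),
          (polyRootCountMod ![g] p : ℝ) * (((x + 1) / p : ℕ) : ℝ) := by
      calc Y * S - d * #((Nat.primesLE x).filter fun p => y < p)
          = ∑ p ∈ (Nat.primesLE x).filter (fun p => y < p),
              (Y * ((polyRootCountMod ![g] p : ℝ) / p) - d) := by
            rw [sum_sub_distrib, ← mul_sum, sum_const, nsmul_eq_mul, mul_comm (d : ℝ)]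
        _ ≤ ∑ p ∈ (Nat.primesLE x).filter (fun p => y < p),
              (polyRootCountMod ![g] p : ℝ) * (((x + 1) / p : ℕ) : ℝ) := by
            refine sum_le_sum fun p hp => ?_
            have hpp := (Nat.mem_primesLE.1 (mem_filter.1 hp).1).2
            have hp0' : (0 : ℝ) < p := by exact_mod_cast hpp.pos
            have hdiv : Y / p - 1 ≤ (((x + 1) / p : ℕ) : ℝ) := by
              rw [← hYnat]; exact div_sub_one_le_cast_div (x + 1) hpp.pos
            have hρ0 : (0 : ℝ) ≤ polyRootCountMod ![g] p := Nat.cast_nonneg _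
            calc Y * ((polyRootCountMod ![g] p : ℝ) / p) - d
                ≤ Y * ((polyRootCountMod ![g] p : ℝ) / p) - polyRootCountMod ![g] p := by
                  gcongr; exact hρd p hpp
              _ = (polyRootCountMod ![g] p : ℝ) * (Y / p - 1) := by field_simp
              _ ≤ (polyRootCountMod ![g] p : ℝ) * (((x + 1) / p : ℕ) : ℝ) := by gcongr
    have hn0 : (0 : ℝ) ≤ n₀ := Nat.cast_nonneg _
    have hd0 : (0 : ℝ) ≤ d := Nat.cast_nonneg _
    nlinarith [h0', h1, hP, hP']
  rw [le_div_iff₀ hY0]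
  nlinarith [hlower, hS]

/-- **Theorem B — rough Mertens from below along a Bateman–Horn system.**  For every Bateman–Horn system
`f = (f_1,…,f_k)` there is `C` with
`k·(log log x − log log y) − C ≤ (x+1)⁻¹ Σ_{0 ≤ n ≤ x} roughStat f y n` for all `2 ≤ y ≤ x`,
`roughStat f y n = Σ_i Σ_{p^v ∥ f_i(n), p > y} min(v,2)` (the skeleton's rough statistic, written out): the mean
number of prime factors `> y` of the values is at least `k·log(log x/log y) − C` (sum over `i` of the
one-polynomial bounds). -/
theorem roughMertens_lower : ∀ (k : ℕ) (f : Fin k → Polynomial ℤ),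
    Literature.NumberTheory.Sieve.IsBatemanHornSystem f →
    ∃ C : ℝ, ∀ x y : ℕ, 2 ≤ y → y ≤ x →
      (k : ℝ) * (Real.log (Real.log (x : ℝ)) - Real.log (Real.log (y : ℝ))) - C ≤
        ((∑ n ∈ Finset.range (x + 1), ∑ i, (((f i).eval (n : ℤ)).toNat.factorization.sum
          fun p v => if y < p then min v 2 else 0) : ℕ) : ℝ) / ((x : ℝ) + 1) := by
  intro k f hf
  choose C hC using fun i => loglog_sub_loglog_sub_le_sum_roughCapped_div (hf.irreducible i)
    (hf.natDegree_pos i) (hf.leadingCoeff_pos i)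
  refine ⟨∑ i, C i, fun x y hy hyx => ?_⟩
  have key : ((∑ n ∈ range (x + 1), ∑ i, (((f i).eval (n : ℤ)).toNat.factorization.sum
        fun p v => if y < p then min v 2 else 0) : ℕ) : ℝ) / ((x : ℝ) + 1) =
      ∑ i, (((∑ n ∈ range (x + 1), (((f i).eval (n : ℤ)).toNat.factorization.sum
        fun p v => if y < p then min v 2 else 0) : ℕ) : ℝ) / ((x : ℝ) + 1)) := by
    rw [sum_comm]
    push_cast
    rw [sum_div]
  have hk : (k : ℝ) * (Real.log (Real.log (x : ℝ)) - Real.log (Real.log (y : ℝ))) - ∑ i, C i =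
      ∑ i : Fin k, ((Real.log (Real.log (x : ℝ)) - Real.log (Real.log (y : ℝ))) - C i) := by
    rw [sum_sub_distrib, sum_const, card_univ, Fintype.card_fin, nsmul_eq_mul]
  rw [key, hk]
  exact sum_le_sum fun i _ => hC i x y hy hyx

/-- The line's cut `y_A(x) = ⌊exp(log x/(log log x)^A)⌋₊` (`A ≥ 0`) satisfies, for `x ≥ x₀(A)`:
`2 ≤ y_A(x) ≤ x`, `log y_A(x) ≤ log x/(log log x)^A` and `log log y_A(x) ≤ log log x − A·log log log x`
(from `(log t)^A = o(t)` at `t = log x`, `isLittleO_log_rpow_rpow_atTop`). -/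
theorem roughCutoff_eventually (A : ℝ) (hA : 0 ≤ A) :
    ∃ x₀ : ℕ, ∀ x : ℕ, x₀ ≤ x →
      2 ≤ Nat.floor (Real.exp (Real.log (x : ℝ) / Real.log (Real.log (x : ℝ)) ^ A)) ∧
      Nat.floor (Real.exp (Real.log (x : ℝ) / Real.log (Real.log (x : ℝ)) ^ A)) ≤ x ∧
      Real.log (Nat.floor (Real.exp (Real.log (x : ℝ) / Real.log (Real.log (x : ℝ)) ^ A)) : ℝ) ≤
        Real.log (x : ℝ) / Real.log (Real.log (x : ℝ)) ^ A ∧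
      Real.log (Real.log (Nat.floor (Real.exp (Real.log (x : ℝ) / Real.log (Real.log (x : ℝ)) ^ A)) : ℝ)) ≤
        Real.log (Real.log (x : ℝ)) - A * Real.log (Real.log (Real.log (x : ℝ))) := by
  -- `(log log x)^A ≤ log x` and `e^e ≤ x` for `x ≥ x₀`
  have hev : ∀ᶠ x : ℕ in Filter.atTop, ‖Real.log (Real.log (x : ℝ)) ^ A‖ ≤ 1 * ‖Real.log (x : ℝ) ^ (1 : ℝ)‖ :=
    ((isLittleO_log_rpow_rpow_atTop A one_pos).comp_tendsto
      (Real.tendsto_log_atTop.comp tendsto_natCast_atTop_atTop)).def one_pos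
  have hev2 : ∀ᶠ x : ℕ in Filter.atTop, Real.exp (Real.exp 1) ≤ (x : ℝ) :=
    tendsto_natCast_atTop_atTop.eventually_ge_atTop _
  obtain ⟨x₀, hx₀⟩ := Filter.eventually_atTop.1 (hev.and hev2)
  refine ⟨x₀, fun x hx => ?_⟩
  obtain ⟨h1, h2⟩ := hx₀ x hx
  set L : ℝ := Real.log (x : ℝ) with hL
  set ℓ : ℝ := Real.log L with hℓ
  have hx0 : (0 : ℝ) < x := lt_of_lt_of_le (Real.exp_pos _) h2
  have hL1 : Real.exp 1 ≤ L := by simpa using Real.log_le_log (Real.exp_pos _) h2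
  have hL0 : 0 < L := lt_of_lt_of_le (Real.exp_pos _) hL1
  have hℓ1 : 1 ≤ ℓ := by simpa using Real.log_le_log (Real.exp_pos _) hL1
  have hℓ0 : 0 < ℓ := lt_of_lt_of_le one_pos hℓ1
  have hu1 : 1 ≤ ℓ ^ A := Real.one_le_rpow hℓ1 hA
  have hu0 : 0 < ℓ ^ A := lt_of_lt_of_le one_pos hu1
  have huL : ℓ ^ A ≤ L := by
    rw [one_mul, Real.rpow_one, Real.norm_of_nonneg hu0.le, Real.norm_of_nonneg hL0.le] at h1
    exact h1
  set E : ℝ := L / ℓ ^ A with hE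
  have hE1 : 1 ≤ E := by rw [hE, le_div_iff₀ hu0, one_mul]; exact huL
  have hEL : E ≤ L := div_le_self hL0.le hu1
  set y : ℕ := ⌊Real.exp E⌋₊ with hy
  have hy2 : 2 ≤ y := Nat.le_floor (by push_cast; linarith [Real.exp_one_gt_d9, Real.exp_le_exp.2 hE1])
  have hyx : y ≤ x := Nat.floor_le_of_le ((Real.exp_le_exp.2 hEL).trans (by rw [hL, Real.exp_log hx0]))
  have hy0 : (0 : ℝ) < y := by exact_mod_cast (show 0 < y by omega)
  have hlogy : Real.log (y : ℝ) ≤ E := by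
    rw [← Real.log_exp E]
    exact Real.log_le_log hy0 (Nat.floor_le (Real.exp_pos E).le)
  have hlogy0 : 0 < Real.log (y : ℝ) := Real.log_pos (by exact_mod_cast (show 1 < y by omega))
  have hloglogy : Real.log (Real.log (y : ℝ)) ≤ Real.log E := Real.log_le_log hlogy0 hlogy
  rw [hE, Real.log_div hL0.ne' hu0.ne', Real.log_rpow hℓ0] at hloglogy
  exact ⟨hy2, hyx, hlogy, hloglogy⟩

/-- **Theorem B at the line's cut `y_A(x) = ⌊exp(log x/(log log x)^A)⌋₊`** (`u = log x/log y_A = (log log x)^A`):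
for every Bateman–Horn system and every `A ≥ 0` there are `C, x₀` with
`k·A·log log log x − C ≤ (x+1)⁻¹ Σ_{0 ≤ n ≤ x} roughStat f (y_A x) n` for all `x ≥ x₀` (the skeleton's `cutoff A x`). -/
theorem roughMertens_lower_cutoff : ∀ (k : ℕ) (f : Fin k → Polynomial ℤ),
    Literature.NumberTheory.Sieve.IsBatemanHornSystem f → ∀ A : ℝ, 0 ≤ A →
    ∃ C : ℝ, ∃ x₀ : ℕ, ∀ x : ℕ, x₀ ≤ x →
      (k : ℝ) * (A * Real.log (Real.log (Real.log (x : ℝ)))) - C ≤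
        ((∑ n ∈ Finset.range (x + 1), ∑ i, (((f i).eval (n : ℤ)).toNat.factorization.sum
          fun p v => if Nat.floor (Real.exp (Real.log (x : ℝ) / Real.log (Real.log (x : ℝ)) ^ A)) < p
            then min v 2 else 0) : ℕ) : ℝ) / ((x : ℝ) + 1) := by
  intro k f hf A hA
  obtain ⟨C, hC⟩ := roughMertens_lower k f hf
  obtain ⟨x₀, hx₀⟩ := roughCutoff_eventually A hA
  refine ⟨C, x₀, fun x hx => ?_⟩
  obtain ⟨hy2, hyx, -, hll⟩ := hx₀ x hx
  refine le_trans ?_ (hC x _ hy2 hyx)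
  have hk : (0 : ℝ) ≤ k := Nat.cast_nonneg k
  nlinarith [mul_le_mul_of_nonneg_left (by linarith [hll] :
    A * Real.log (Real.log (Real.log (x : ℝ))) ≤
      Real.log (Real.log (x : ℝ)) - Real.log (Real.log (Nat.floor (Real.exp (Real.log (x : ℝ) /
        Real.log (Real.log (x : ℝ)) ^ A)) : ℝ))) hk]

/-- **The rough Liouville saving forced by lattice domination (A + B).**  For every Bateman–Horn system
`f = (f_1,…,f_k)` there is `C` such that, whenever `2 ≤ y ≤ x` and the rough polynomial
`R_{x,y} = Σ_{n ≤ x} X^{roughStat f y n}` is lattice-dominated (budget `k`, excess `C₀`, inner radius `r₀ ∈ (0,1]`),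
`‖Σ_{n ≤ x} (−1)^{roughStat f y n}‖ ≤ e^{C + 2(C₀/r₀² + kπ²/6)}·(x+1)·(log y/log x)^{2k}`: the rough Liouville sum
along `f` must save `u^{2k}`, `u = log x/log y`. -/
theorem roughLiouvilleSaving_of_latticeDominated : ∀ (k : ℕ) (f : Fin k → Polynomial ℤ),
    Literature.NumberTheory.Sieve.IsBatemanHornSystem f →
    ∃ C : ℝ, ∀ (C₀ : ℕ) (r₀ : ℝ) (x y : ℕ), 0 < r₀ → r₀ ≤ 1 → 2 ≤ y → y ≤ x →
      (∀ ρ ∈ (∑ n ∈ Finset.range (x + 1), (Polynomial.X : Polynomial ℂ) ^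
          (∑ i, (((f i).eval (n : ℤ)).toNat.factorization.sum fun p v => if y < p then min v 2 else 0))).roots,
        r₀ ≤ ‖(1 : ℂ) - ρ‖) →
      (∀ m : ℕ, ((∑ n ∈ Finset.range (x + 1), (Polynomial.X : Polynomial ℂ) ^
          (∑ i, (((f i).eval (n : ℤ)).toNat.factorization.sum fun p v =>
            if y < p then min v 2 else 0))).roots.filter
            fun ρ : ℂ => ‖(1 : ℂ) - ρ‖ < (m : ℝ) + 1).card ≤ k * m + C₀) →
      ‖∑ n ∈ Finset.range (x + 1), (-1 : ℂ) ^
          (∑ i, (((f i).eval (n : ℤ)).toNat.factorization.sum fun p v => if y < p then min v 2 else 0))‖ ≤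
        Real.exp (C + 2 * ((C₀ : ℝ) / r₀ ^ 2 + (k : ℝ) * (Real.pi ^ 2 / 6))) * ((x : ℝ) + 1) *
          (Real.log (y : ℝ) / Real.log (x : ℝ)) ^ (2 * k) := by
  intro k f hf
  obtain ⟨C, hC⟩ := roughMertens_lower k f hf
  refine ⟨2 * C, fun C₀ r₀ x y hr₀ hr₁ hy hyx hfar hcount => ?_⟩
  have hA := roughLiouville_of_latticeDominated k C₀ r₀ _ x hr₀ hr₁ hfar hcount
  have hB := hC x y hy hyx
  rw [Nat.cast_sum] at hB
  set B : ℝ := (C₀ : ℝ) / r₀ ^ 2 + (k : ℝ) * (Real.pi ^ 2 / 6) with hBdef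
  set L : ℝ := (k : ℝ) * (Real.log (Real.log (x : ℝ)) - Real.log (Real.log (y : ℝ))) with hLdef
  have step : ∀ {M : ℝ}, L - C ≤ M → ((x : ℝ) + 1) * Real.exp (-2 * M + 2 * B) ≤
      Real.exp (2 * C + 2 * B) * ((x : ℝ) + 1) * Real.exp (-2 * L) := by
    intro M hM
    rw [mul_comm (Real.exp (2 * C + 2 * B)), mul_assoc, ← Real.exp_add]
    have hN : (0 : ℝ) ≤ (x : ℝ) + 1 := by positivity
    refine mul_le_mul_of_nonneg_left (Real.exp_le_exp.2 ?_) hN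
    linarith
  refine (hA.trans (step hB)).trans (le_of_eq ?_)
  have hlogx : 0 < Real.log (x : ℝ) := Real.log_pos (by exact_mod_cast (show 1 < x by omega))
  have hlogy : 0 < Real.log (y : ℝ) := Real.log_pos (by exact_mod_cast (show 1 < y by omega))
  have e : -2 * L = ((2 * k : ℕ) : ℝ) * Real.log (Real.log (y : ℝ) / Real.log (x : ℝ)) := by
    rw [hLdef, Real.log_div hlogy.ne' hlogx.ne']
    push_cast
    ring
  rw [e, Real.exp_nat_mul, Real.exp_log (div_pos hlogy hlogx)]

/-- **`RoughLatticeCountFor f` (the conclusion of `FibreUniversality` for `f`, written out) forces a rough Liouville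
saving along `f`.**  If for every `A ≥ 2` the rough polynomial `R_{x, y_A(x)}` of the Bateman–Horn system `f` is
lattice-dominated for `x ≥ x₀` (budget `k`, excess `C₀`, inner radius `r₀ ∈ (0,1]`; `y_A(x) = ⌊exp(log x/(log log x)^A)⌋₊`),
then for every `A ≥ 2`: `‖Σ_{n ≤ x} (−1)^{roughStat f (y_A x) n}‖ ≤ C·(x+1)/u^{2k}`, `u = (log log x)^A`, for `x ≥ x₀'` —
a Chowla/Liouville-type cancellation along the values of `f` for the multiplicative sign `g_y`, `g_y(p^v) = −1` iff
`p > y, v = 1`: for `f = (X, X+2)` a rough two-point correlation, for `deg f ≥ 2` rough one-point Chowla along `f`; the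
parity content of the joint (`Literature.Barriers.Parity.SelbergParityBarrier`). -/
theorem roughLiouvilleSaving_of_roughLatticeCount : ∀ (k : ℕ) (f : Fin k → Polynomial ℤ),
    Literature.NumberTheory.Sieve.IsBatemanHornSystem f →
    (∀ A : ℝ, 2 ≤ A → ∃ C₀ : ℕ, ∃ r₀ : ℝ, 0 < r₀ ∧ r₀ ≤ 1 ∧ ∃ x₀ : ℕ, ∀ x : ℕ, x₀ ≤ x →
      (∀ ρ ∈ (∑ n ∈ Finset.range (x + 1), (Polynomial.X : Polynomial ℂ) ^
          (∑ i, (((f i).eval (n : ℤ)).toNat.factorization.sum fun p v =>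
            if Nat.floor (Real.exp (Real.log (x : ℝ) / Real.log (Real.log (x : ℝ)) ^ A)) < p
            then min v 2 else 0))).roots, r₀ ≤ ‖(1 : ℂ) - ρ‖) ∧
      ∀ m : ℕ, ((∑ n ∈ Finset.range (x + 1), (Polynomial.X : Polynomial ℂ) ^
          (∑ i, (((f i).eval (n : ℤ)).toNat.factorization.sum fun p v =>
            if Nat.floor (Real.exp (Real.log (x : ℝ) / Real.log (Real.log (x : ℝ)) ^ A)) < p
            then min v 2 else 0))).roots.filter fun ρ : ℂ => ‖(1 : ℂ) - ρ‖ < (m : ℝ) + 1).card ≤ k * m + C₀) →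
    ∀ A : ℝ, 2 ≤ A → ∃ C : ℝ, ∃ x₀ : ℕ, ∀ x : ℕ, x₀ ≤ x →
      ‖∑ n ∈ Finset.range (x + 1), (-1 : ℂ) ^
          (∑ i, (((f i).eval (n : ℤ)).toNat.factorization.sum fun p v =>
            if Nat.floor (Real.exp (Real.log (x : ℝ) / Real.log (Real.log (x : ℝ)) ^ A)) < p
            then min v 2 else 0))‖ ≤
        C * ((x : ℝ) + 1) / (Real.log (Real.log (x : ℝ)) ^ A) ^ (2 * k) := by
  intro k f hf hR A hA
  obtain ⟨C, hC⟩ := roughLiouvilleSaving_of_latticeDominated k f hf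
  obtain ⟨C₀, r₀, hr₀, hr₁, x₁, hlat⟩ := hR A hA
  obtain ⟨x₂, hx₂⟩ := roughCutoff_eventually A (by linarith)
  refine ⟨Real.exp (C + 2 * ((C₀ : ℝ) / r₀ ^ 2 + (k : ℝ) * (Real.pi ^ 2 / 6))), max x₁ x₂, fun x hx => ?_⟩
  obtain ⟨hy2, hyx, hlogy, -⟩ := hx₂ x (le_of_max_le_right hx)
  obtain ⟨hfar, hcount⟩ := hlat x (le_of_max_le_left hx)
  refine (hC C₀ r₀ x _ hr₀ hr₁ hy2 hyx hfar hcount).trans ?_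
  set y : ℕ := Nat.floor (Real.exp (Real.log (x : ℝ) / Real.log (Real.log (x : ℝ)) ^ A)) with hy
  set u : ℝ := Real.log (Real.log (x : ℝ)) ^ A with hu
  have hlogx : 0 < Real.log (x : ℝ) := Real.log_pos (by exact_mod_cast (show 1 < x by omega))
  have hlogy0 : 0 < Real.log (y : ℝ) := Real.log_pos (by exact_mod_cast (show 1 < y by omega))
  have hu0 : 0 < u := by
    by_contra h
    have : Real.log (x : ℝ) / u ≤ 0 := div_nonpos_of_nonneg_of_nonpos hlogx.le (not_lt.1 h)
    linarith
  have hratio : Real.log (y : ℝ) / Real.log (x : ℝ) ≤ u⁻¹ := by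
    rw [div_le_iff₀ hlogx, inv_mul_eq_div]
    exact hlogy
  have hpow : (Real.log (y : ℝ) / Real.log (x : ℝ)) ^ (2 * k) ≤ (u ^ (2 * k))⁻¹ := by
    rw [← inv_pow]
    exact pow_le_pow_left₀ (div_nonneg hlogy0.le hlogx.le) hratio _
  have hN : (0 : ℝ) ≤ (x : ℝ) + 1 := by positivity
  rw [mul_div_assoc, mul_assoc]
  refine mul_le_mul_of_nonneg_left ?_ (Real.exp_pos _).le
  calc ((x : ℝ) + 1) * (Real.log (y : ℝ) / Real.log (x : ℝ)) ^ (2 * k)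
      ≤ ((x : ℝ) + 1) * (u ^ (2 * k))⁻¹ := mul_le_mul_of_nonneg_left hpow hN
    _ = ((x : ℝ) + 1) / u ^ (2 * k) := (div_eq_mul_inv _ _).symm

end Summit.Parity.BatemanHorn.Cruxes.SystemZeroRepulsion.BuchstabFlowHyperbolicity
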